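import Summits.Ventures.PercRepro.ProfilePointedCircuitClassesFiveCoreIII

/-!
# PercRepro — THE BOTTOM-LEVEL PER-CIRCUIT CLAIM AT NULLITY 5, IV: THE LOCAL LYM OF THE CLASS `#C = 3`
(p5, gen 37; `proofs/P5-GM1.md` §53(e); the nullity-4 template is `ProfilePointedCircuitClassesCoreLYM`)

`local_lym_five_of_card_eq_three`: on every containment edge `W ⊆ V` of a class `#C = 3` on `#E = ρ(E) + 5`,
`ρ(E) ≥ 7`, the demands below `V` are at most the units above `W` — the three-type injection (`W ↦ V`;
`card_typeII_five_le`; `card_typeIII_five_le`).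
-/

open scoped Matroid

namespace PercRepro.Cogirth

open Finset ThmH Skew Shadow Profile

variable {α : Type} [DecidableEq α] {N : Matroid α} [N.Finite]

section FiveLYM

/-- **THE LOCAL LYM OF THE CLASS `#C = 3` AT NULLITY 5** (§53(e), the two-free-point class): on every containment
edge `W ⊆ V` of the class, the demands below `V` inject into the units above `W` — `W` itself to `V`; a demand `W'`
with `W' ∩ W = C` (`W' = C + p' + q'`) to `E − x − (p' + q' + t₁ + t₂ + t₃)` with `t₁ ∈ T := (E − x) ∖ V` not a
coloop of `X := E ∖ (p' + q')` and `t₂` not a coloop of `X − t₁`; a demand `W'` with `#(W' ∩ W) = 4`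
(`W' = C + σ + q'`, `σ ∈ W ∖ C = {p, q}`) to `(V − q') + t` with `t ∈ T` not in `cl(V − q')`, a different `t` for
`σ = p` and `σ = q` (`two_le_card_filter_valid_five`); the three images meet `T` in `0`, `2`, `1` points. -/
theorem local_lym_five_of_card_eq_three (hn : (gr N).card = rk N (gr N) + 5) (hR : 7 ≤ rk N (gr N)) (x : α)
    {C : Finset α} (hC : C.card = 3) {W V : Finset α}
    (hW : W ∈ (biIndepSets N 5).filter (fun W => x ∉ W ∧ x ∈ clF N W ∧ fundC N W x = C))
    (hV : V ∈ (biIndepSets N ((gr N).card - 6)).filter (fun V => x ∉ V ∧ x ∈ clF N V ∧ fundC N V x = C))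
    (hWV : W ⊆ V) :
    (((biIndepSets N 5).filter (fun W => x ∉ W ∧ x ∈ clF N W ∧ fundC N W x = C)).filter
        (fun W' => W' ⊆ V)).card ≤
      (((biIndepSets N ((gr N).card - 6)).filter (fun V => x ∉ V ∧ x ∈ clF N V ∧ fundC N V x = C)).filter
        (fun V' => W ⊆ V')).card := by
  -- unpack the demand `W` and the unit `V`
  have hW' := hW
  rw [mem_filter, mem_biIndepSets] at hW'
  obtain ⟨⟨hWg, hWcard, hWrk, hWcompl⟩, hxW, hxcl, hfund⟩ := hW'
  have hV' := hV
  rw [mem_filter, mem_biIndepSets] at hV'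
  obtain ⟨⟨hVg, hVcard, hVrk, hVcompl⟩, hxV, hxclV, hfundV⟩ := hV'
  have hxg : x ∈ gr N := clF_subset_gr W hxcl
  have hCW : C ⊆ W := hfund ▸ fundC_subset W x
  have hCV : C ⊆ V := hCW.trans hWV
  have hxC : x ∈ clF N C := by
    have h := mem_clF_sdiff_of_forall_notMem_fundC hxg hWg hWrk hxcl (W \ C) sdiff_subset
      (fun w hw => by rw [hfund]; exact (mem_sdiff.1 hw).2)
    rwa [Finset.sdiff_sdiff_eq_self hCW] at h
  -- the two points of `W ∖ C`
  have hWC2 : (W \ C).card = 2 := by rw [card_sdiff_of_subset hCW]; omega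
  obtain ⟨p, q, hpq, hWC⟩ := card_eq_two.1 hWC2
  have hpW : p ∈ W := (mem_sdiff.1 (hWC ▸ mem_insert_self p {q})).1
  have hqW : q ∈ W := (mem_sdiff.1 (hWC ▸ mem_insert_of_mem (mem_singleton_self q))).1
  have hpC : p ∉ C := (mem_sdiff.1 (hWC ▸ mem_insert_self p {q})).2
  have hqC : q ∉ C := (mem_sdiff.1 (hWC ▸ mem_insert_of_mem (mem_singleton_self q))).2
  -- `T := (E − x) ∖ V`, five points avoiding `W`
  have hVE : V ⊆ (gr N).erase x := fun a ha => mem_erase.2 ⟨fun h => hxV (h ▸ ha), hVg ha⟩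
  have hWE : W ⊆ (gr N).erase x := hWV.trans hVE
  have hT5 : ((gr N).erase x \ V).card = 5 := by
    rw [card_sdiff_of_subset hVE, card_erase_of_mem hxg, hVcard]
    omega
  have hTg : (gr N).erase x \ V ⊆ gr N := sdiff_subset.trans (erase_subset _ _)
  have hTV : ∀ t ∈ (gr N).erase x \ V, t ∉ V := fun t ht => (mem_sdiff.1 ht).2
  have hTW : ∀ t ∈ (gr N).erase x \ V, t ∉ W := fun t ht h => (mem_sdiff.1 ht).2 (hWV h)
  have hTx : ∀ t ∈ (gr N).erase x \ V, t ≠ x := fun t ht => (mem_erase.1 (mem_sdiff.1 ht).1).1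
  -- a unit above `W` is determined by its «hole» `(E − x) ∖ V'`; membership of such a set in the unit class
  have hunit : ∀ T' : Finset α, T' ⊆ (gr N).erase x \ W → T'.card = 5 →
      rk N (gr N) ≤ rk N (gr N \ T') + 1 →
      (gr N).erase x \ T' ∈ ((biIndepSets N ((gr N).card - 6)).filter
        (fun V => x ∉ V ∧ x ∈ clF N V ∧ fundC N V x = C)).filter (fun V' => W ⊆ V') := by
    intro T' hT'S hT'5 hrkT'
    have hWV' : W ⊆ (gr N).erase x \ T' := fun a ha =>
      mem_sdiff.2 ⟨hWE ha, fun h => (mem_sdiff.1 (hT'S h)).2 ha⟩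
    have hV'g : (gr N).erase x \ T' ⊆ gr N := sdiff_subset.trans (erase_subset _ _)
    have hxV' : x ∉ (gr N).erase x \ T' := fun h => (mem_erase.1 (mem_sdiff.1 h).1).1 rfl
    have hxclV' : x ∈ clF N ((gr N).erase x \ T') := mem_clF_of_subset (hCW.trans hWV') hxC
    have hT'E : T' ⊆ (gr N).erase x := hT'S.trans sdiff_subset
    have hcard' : ((gr N).erase x \ T').card = (gr N).card - 6 := by
      rw [card_sdiff_of_subset hT'E, card_erase_of_mem hxg, hT'5]
      omega
    have e : insert x ((gr N).erase x \ T') = gr N \ T' := by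
      ext a
      simp only [mem_insert, mem_sdiff, mem_erase]
      constructor
      · rintro (rfl | ⟨⟨_, hag⟩, haT⟩)
        · exact ⟨hxg, fun h => (mem_erase.1 (hT'E h)).1 rfl⟩
        · exact ⟨hag, haT⟩
      · rintro ⟨hag, haT⟩
        by_cases hax : a = x
        · exact Or.inl hax
        · exact Or.inr ⟨⟨hax, hag⟩, haT⟩
    have hrkV' : rk N ((gr N).erase x \ T') = ((gr N).erase x \ T').card := by
      have h1 : rk N (insert x ((gr N).erase x \ T')) = rk N ((gr N).erase x \ T') := by
        rw [rk_insert_eq hxg hV'g, if_pos hxclV']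
      rw [e] at h1
      have h2 := rk_le_card (M := N) ((gr N).erase x \ T')
      rw [hcard'] at h2 ⊢
      omega
    rw [mem_filter, mem_filter, mem_biIndepSets]
    refine ⟨⟨⟨hV'g, hcard', hrkV', ?_⟩, hxV', hxclV', ?_⟩, hWV'⟩
    · apply rk_eq_card_of_subset_of_rk_eq_card _ hWcompl
      intro a ha
      rw [mem_sdiff] at ha ⊢
      refine ⟨ha.1, fun h => ha.2 (hWV' h)⟩
    · exact fundC_eq_of_subset hWg hWrk hxcl hfund hxC hWV' hV'g hrkV' hxclV'
  -- a demand below `V` is `C` plus two points of `V ∖ C`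
  have hdem : ∀ W' ∈ ((biIndepSets N 5).filter (fun W => x ∉ W ∧ x ∈ clF N W ∧ fundC N W x = C)).filter
      (fun W' => W' ⊆ V), C ⊆ W' ∧ W'.card = 5 ∧ W' ⊆ V ∧ rk N (gr N \ W') = (gr N \ W').card := by
    intro W' hW'
    rw [mem_filter, mem_filter, mem_biIndepSets] at hW'
    obtain ⟨⟨⟨_, hc, _, hcompl⟩, _, _, hf⟩, hsub⟩ := hW'
    exact ⟨hf ▸ fundC_subset W' x, hc, hsub, hcompl⟩
  -- the spanning sets `E − q'` for `q' ∈ W'`, `W'` a demand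
  have hspan : ∀ W' ∈ ((biIndepSets N 5).filter (fun W => x ∉ W ∧ x ∈ clF N W ∧ fundC N W x = C)).filter
      (fun W' => W' ⊆ V), ∀ S ⊆ W', rk N (gr N \ S) = rk N (gr N) := by
    intro W' hW' S hS
    obtain ⟨_, hc, _, hcompl⟩ := hdem W' hW'
    have h1 : rk N (gr N \ W') ≤ rk N (gr N \ S) := rk_le_rk_of_subset_finset (sdiff_subset_sdiff (Subset.refl _) hS)
    have h2 : rk N (gr N \ S) ≤ rk N (gr N) := rk_le_rk_of_subset_finset sdiff_subset
    have hW'g : W' ⊆ gr N := ((hdem W' hW').2.2.1).trans hVg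
    rw [hcompl, card_sdiff_of_subset hW'g, hc] at h1
    omega
  -- names for the two sides
  obtain ⟨Dv, hDv⟩ : ∃ Dv : Finset (Finset α), Dv = ((biIndepSets N 5).filter
    (fun W => x ∉ W ∧ x ∈ clF N W ∧ fundC N W x = C)).filter (fun W' => W' ⊆ V) := ⟨_, rfl⟩
  obtain ⟨Uw, hUw⟩ : ∃ Uw : Finset (Finset α), Uw = ((biIndepSets N ((gr N).card - 6)).filter
    (fun V => x ∉ V ∧ x ∈ clF N V ∧ fundC N V x = C)).filter (fun V' => W ⊆ V') := ⟨_, rfl⟩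
  rw [← hDv, ← hUw]
  have hdem' : ∀ W' ∈ Dv, C ⊆ W' ∧ W'.card = 5 ∧ W' ⊆ V ∧ rk N (gr N \ W') = (gr N \ W').card :=
    fun W' hW' => hdem W' (hDv ▸ hW')
  have hspan' : ∀ W' ∈ Dv, ∀ S ⊆ W', rk N (gr N \ S) = rk N (gr N) :=
    fun W' hW' => hspan W' (hDv ▸ hW')
  have hunit' : ∀ T' : Finset α, T' ⊆ (gr N).erase x \ W → T'.card = 5 →
      rk N (gr N) ≤ rk N (gr N \ T') + 1 → (gr N).erase x \ T' ∈ Uw :=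
    fun T' h1 h2 h3 => hUw ▸ hunit T' h1 h2 h3
  have hVUw : V ∈ Uw := hUw ▸ mem_filter.2 ⟨hV, hWV⟩
  -- the valid points for the type (iii) moves, with two distinct representatives
  have hvalid : ∀ q' ∈ V, q' ∉ C → rk N ((gr N).erase q') = rk N (gr N) →
      ∃ a b, a ∈ ((gr N).erase x \ V).filter (fun t => t ∉ clF N (V.erase q')) ∧
        b ∈ ((gr N).erase x \ V).filter (fun t => t ∉ clF N (V.erase q')) ∧ a ≠ b := by
    intro q' hq'V hq'C hq
    have h := two_le_card_filter_valid_five hVg hVrk hxV hCV hxC hq'V hq'C hq hT5 (by omega) hn hR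
    obtain ⟨a, ha, b, hb, hab⟩ := one_lt_card.1
      (show 1 < (((gr N).erase x \ V).filter (fun t => t ∉ clF N (V.erase q'))).card by omega)
    exact ⟨a, b, ha, hb, hab⟩
  classical
  let ta : α → α := fun q' => if h : ∃ a b, a ∈ ((gr N).erase x \ V).filter (fun t => t ∉ clF N (V.erase q')) ∧
      b ∈ ((gr N).erase x \ V).filter (fun t => t ∉ clF N (V.erase q')) ∧ a ≠ b then Classical.choose h else x
  let tb : α → α := fun q' => if h : ∃ a b, a ∈ ((gr N).erase x \ V).filter (fun t => t ∉ clF N (V.erase q')) ∧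
      b ∈ ((gr N).erase x \ V).filter (fun t => t ∉ clF N (V.erase q')) ∧ a ≠ b then
      Classical.choose (Classical.choose_spec h) else x
  have hta : ∀ q' ∈ V, q' ∉ C → rk N ((gr N).erase q') = rk N (gr N) →
      ta q' ∈ ((gr N).erase x \ V).filter (fun t => t ∉ clF N (V.erase q')) ∧
      tb q' ∈ ((gr N).erase x \ V).filter (fun t => t ∉ clF N (V.erase q')) ∧ ta q' ≠ tb q' := by
    intro q' hq'V hq'C hq
    have h := hvalid q' hq'V hq'C hq
    simp only [ta, tb, dif_pos h]
    exact Classical.choose_spec (Classical.choose_spec h)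
  -- THE THREE PARTS OF THE DEMANDS AND THE UNITS
  have hsplit : Dv.card = (Dv.filter (fun W' => W' = W)).card +
      ((Dv.filter (fun W' => ¬ W' = W ∧ (W' ∩ W).card = 4)).card +
        (Dv.filter (fun W' => ¬ W' = W ∧ ¬ (W' ∩ W).card = 4)).card) := by
    have e1 := card_filter_add_card_filter_not (s := Dv) (fun W' => W' = W)
    have e2 := card_filter_add_card_filter_not (s := Dv.filter (fun W' => ¬ W' = W))
      (fun W' => (W' ∩ W).card = 4)
    have e3 := filter_filter (fun W' => ¬ W' = W) (fun W' => (W' ∩ W).card = 4) Dv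
    have e4 := filter_filter (fun W' => ¬ W' = W) (fun W' => ¬ (W' ∩ W).card = 4) Dv
    rw [e3, e4] at e2
    omega
  have hmerge : (Uw.filter (fun V' => (V' ∩ ((gr N).erase x \ V)).card = 0)).card +
      ((Uw.filter (fun V' => (V' ∩ ((gr N).erase x \ V)).card = 1)).card +
        (Uw.filter (fun V' => (V' ∩ ((gr N).erase x \ V)).card = 2)).card) ≤ Uw.card := by
    rw [← card_union_of_disjoint, ← card_union_of_disjoint]
    · apply card_le_card
      intro V' hV'
      simp only [mem_union, mem_filter] at hV'
      rcases hV' with h | h | h <;> exact h.1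
    · rw [disjoint_left]
      intro V' h1 h2
      rw [mem_union, mem_filter, mem_filter] at h2
      rw [mem_filter] at h1
      rcases h2 with h2 | h2 <;> omega
    · rw [disjoint_left]
      intro V' h1 h2
      rw [mem_filter] at h1 h2
      omega
  -- (i) `W ↦ V`
  have hi : (Dv.filter (fun W' => W' = W)).card ≤
      (Uw.filter (fun V' => (V' ∩ ((gr N).erase x \ V)).card = 0)).card := by
    rcases (Dv.filter (fun W' => W' = W)).eq_empty_or_nonempty with hemp | ⟨W', hW'⟩
    · rw [hemp, card_empty]
      exact Nat.zero_le _
    · have hle : (Dv.filter (fun W' => W' = W)).card ≤ 1 :=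
        card_le_one.2 (fun a ha b hb => by rw [(mem_filter.1 ha).2, (mem_filter.1 hb).2])
      have hpos : 0 < (Uw.filter (fun V' => (V' ∩ ((gr N).erase x \ V)).card = 0)).card := by
        apply card_pos.2
        refine ⟨V, mem_filter.2 ⟨hVUw, ?_⟩⟩
        rw [card_eq_zero, eq_empty_iff_forall_notMem]
        intro a ha
        rw [mem_inter] at ha
        exact hTV a ha.2 ha.1
      omega
  have hii := card_typeII_five_le hn x Dv Uw hC hWcard hxV hVg hVE hVcard hVrk hCW hT5 hTg hTV hTW hdem' hspan' hunit'
  have hiii := card_typeIII_five_le hn x Dv Uw hC hWcard hxV hVg hVE hVcard hVrk hCW hT5 hTg hTV hTW hdem' hspan' hunit' hpq hWC ta tb hta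
  -- the assembly
  calc Dv.card = (Dv.filter (fun W' => W' = W)).card +
        ((Dv.filter (fun W' => ¬ W' = W ∧ (W' ∩ W).card = 4)).card +
          (Dv.filter (fun W' => ¬ W' = W ∧ ¬ (W' ∩ W).card = 4)).card) := hsplit
    _ ≤ (Uw.filter (fun V' => (V' ∩ ((gr N).erase x \ V)).card = 0)).card +
        ((Uw.filter (fun V' => (V' ∩ ((gr N).erase x \ V)).card = 1)).card +
          (Uw.filter (fun V' => (V' ∩ ((gr N).erase x \ V)).card = 2)).card) := by
        have := hi; have := hii; have := hiii; omega
    _ ≤ Uw.card := hmerge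



end FiveLYM

end PercRepro.Cogirth
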